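import Mathlib.LinearAlgebra.Matrix.NonsingularInverse
import Literature.Computability.AlgebraicComplexity.QuantumFunctionals
import HarnessLib

/-!
# Supports of a tensor in two bases: Strassen's permutation lemma (CVZ Prop. 2.16) in coordinates

Topic: `Literature/Computability/AlgebraicComplexity` (support file for Strassen's support functionals,
`QuantumFunctionals.lean`). The combinatorial-linear-algebra core of Strassen's inequality
`ζ^θ ≥ ζ_θ` between the upper and the lower support functional ([Str91, §4]; [CVZ23, Prop. 2.16 and
Thm. 2.15]) in the special case needed for *oblique* tensors (CVZ Def. 2.18, Thm. 2.19): a tensor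
`t : ι → κ → μ → K` whose support in the standard bases is an antichain for the product of three total
orders (given by injective weights `w₁, w₂, w₃` into linear orders), compared with its coordinates
`(A ⊗ B ⊗ C)·t` (`actTensor A B C t`, `A, B, C` invertible) in arbitrary bases (the rows of `A, B, C`),
the new index sets being totally ordered by arbitrary injective ranks `r₁, r₂, r₃`.

* `exists_injective_leading` — one factor (CVZ Prop. 2.16, first half of the proof): for an
  invertible `A`, ranks `r` and weights `w` there is an injection `φ : ι → ι` such that for every
  standard index `β` the increasing flag space `V_{≤ φ β} = span {row_{α'} A : r α' ≤ r (φ β)}` contains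
  a vector with *leading term* `β` (coordinate `1` at `β`, `0` at all `β'` of smaller weight);
  `φ β` is the `r`-minimal such index and minimality forces injectivity.
* `exists_injective_support_le` — three factors (CVZ Prop. 2.16 with `M_G f = supp f` for an antichain
  support, i.e. the inclusion `(φ₁ × φ₂ × φ₃)(supp t) ⊆ supp_F ((A ⊗ B ⊗ C)·t)` for the flags `F` of the
  new bases): for every `x ∈ supp t` there is a point `y ∈ supp ((A ⊗ B ⊗ C)·t)` with
  `rᵢ yᵢ ≤ rᵢ (φᵢ xᵢ)` for `i = 1, 2, 3`.

Flags are written out in coordinates (`∃ c, (∀ α', r α < r α' → c α' = 0) ∧ p = ∑ c α' • row_{α'}`),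
so the file introduces no definitions. CVZ phrase Prop. 2.16 with decreasing flags and maximal points;
here the flags on the new bases are increasing, which is the same statement for the reversed ranks.

References: V. Strassen, *Degeneration and complexity of bilinear maps: some asymptotic spectra*,
J. reine angew. Math. 413 (1991), 127–180, §4; M. Christandl, P. Vrana, J. Zuiddam, *Universal points
in the asymptotic spectrum of tensors*, J. Amer. Math. Soc. 36 (2023), Prop. 2.16.
-/

noncomputable section

open scoped BigOperators

namespace Literature.Computability.AlgebraicComplexity

/-! ## One factor: flags of the new basis against leading terms in the standard basis -/

section OneFactor

variable {K : Type*} [Field K] {ι : Type*} [Fintype ι] [DecidableEq ι]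
variable {R W : Type*} [LinearOrder R] [LinearOrder W]

omit [DecidableEq ι] in
/-- Descent: a nonzero vector of the flag space `V_{≤α}` whose `α`-coefficient (indeed every coefficient
of rank `≥ r α`) vanishes lies in a strictly smaller flag space `V_{≤α₀}`, `r α₀ < r α`. [folklore] -/
theorem exists_lt_of_coeff_eq_zero (A : Matrix ι ι K) (r : ι → R) (α : ι) (d : ι → K)
    (hd : ∀ α', r α ≤ r α' → d α' = 0) (q : ι → K) (hq : q = fun j => ∑ α', d α' * A α' j)
    (hq0 : q ≠ 0) :
    ∃ α₀, r α₀ < r α ∧ ∃ d' : ι → K, (∀ α', r α₀ < r α' → d' α' = 0) ∧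
      q = fun j => ∑ α', d' α' * A α' j := by
  classical
  have hex : ∃ α', d α' ≠ 0 := by
    by_contra h
    push Not at h
    apply hq0
    rw [hq]
    funext j
    simp [h]
  obtain ⟨α₁, hα₁⟩ := hex
  have hlt : r α₁ < r α := lt_of_not_ge fun h => hα₁ (hd α₁ h)
  obtain ⟨α₀, hα₀, hmax⟩ := Finset.exists_max_image (Finset.univ.filter fun α' => r α' < r α) r
    ⟨α₁, by simp [hlt]⟩
  refine ⟨α₀, (Finset.mem_filter.1 hα₀).2, d, fun α' h' => ?_, hq⟩
  by_contra hne
  have h1 : r α' < r α := lt_of_not_ge fun h => hne (hd α' h)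
  exact absurd h' (not_lt.2 (hmax α' (by simp [h1])))

/-- **CVZ Prop. 2.16, one factor.** Let `A` be invertible (its rows a basis `(v_α)` of `K^ι`), `r` an
injective rank on the new indices and `w` an injective weight on the standard indices. There is an
injection `φ : ι → ι` such that for every `β` the flag space `V_{≤ φ β} = span {v_{α'} : r α' ≤ r (φ β)}`
contains a vector `p` with leading term `β`: `p β = 1` and `p β' = 0` whenever `w β' < w β`. (Take
`φ β` `r`-minimal with this property; if `φ β = φ γ = α` with `w β < w γ`, eliminating the
`v_α`-coefficient between the two witnesses produces a witness in a smaller flag space.)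
[cite: ChristandlVranaZuiddam2023, Prop. 2.16] -/
theorem exists_injective_leading (A : Matrix ι ι K) (hA : IsUnit A.det) (r : ι → R)
    (hr : Function.Injective r) (w : ι → W) (hw : Function.Injective w) :
    ∃ φ : ι → ι, Function.Injective φ ∧ ∀ β, ∃ (c : ι → K) (p : ι → K),
      (∀ α', r (φ β) < r α' → c α' = 0) ∧ (p = fun j => ∑ α', c α' * A α' j) ∧
      p β = 1 ∧ ∀ β', w β' < w β → p β' = 0 := by
  classical
  let T : ι → ι → Prop := fun β α => ∃ (c : ι → K) (p : ι → K),
      (∀ α', r α < r α' → c α' = 0) ∧ (p = fun j => ∑ α', c α' * A α' j) ∧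
      p β = 1 ∧ ∀ β', w β' < w β → p β' = 0
  -- `T β` is nonempty: the `r`-maximal index, with `p = δ_β` (the rows of `A` span everything)
  have hT : ∀ β, ∃ α, T β α := by
    intro β
    obtain ⟨αm, -, hαm⟩ := Finset.exists_max_image Finset.univ r ⟨β, Finset.mem_univ _⟩
    refine ⟨αm, Matrix.vecMul (Pi.single β 1) A⁻¹, Pi.single β 1, fun α' h => ?_, ?_, ?_, ?_⟩
    · exact absurd (hαm α' (Finset.mem_univ _)) (not_le.2 h)
    · have h : Matrix.vecMul (Matrix.vecMul (Pi.single β (1 : K)) A⁻¹) A = Pi.single β 1 := by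
        rw [Matrix.vecMul_vecMul, Matrix.nonsing_inv_mul A hA, Matrix.vecMul_one]
      conv_lhs => rw [← h]
      rfl
    · simp
    · intro β' h
      simp [ne_of_apply_ne w h.ne]
  -- `φ β` := an `r`-minimal element of `T β`
  have hmin : ∀ β, ∃ α, T β α ∧ ∀ α', T β α' → r α ≤ r α' := by
    intro β
    obtain ⟨α₁, hα₁⟩ := hT β
    obtain ⟨α, hα, h⟩ := Finset.exists_min_image (Finset.univ.filter (T β)) r ⟨α₁, by simp [hα₁]⟩
    exact ⟨α, (Finset.mem_filter.1 hα).2, fun α' h' => h α' (by simp [h'])⟩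
  choose φ hφT hφmin using hmin
  refine ⟨φ, ?_, fun β => hφT β⟩
  -- injectivity, asymmetric form
  have key : ∀ β γ, w β < w γ → φ β = φ γ → False := by
    intro β γ hβγ heq
    obtain ⟨c, p, hc, hp, hpβ, hpz⟩ := hφT β
    obtain ⟨d, q, hdq, hq, hqγ, hqz⟩ := hφT γ
    rw [← heq] at hdq
    by_cases hdα : d (φ β) = 0
    · -- `q` already lies in `V_{< φ β}`
      have hd' : ∀ α', r (φ β) ≤ r α' → d α' = 0 := by
        intro α' h
        rcases h.eq_or_lt with h | h
        · rw [← hr h]; exact hdα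
        · exact hdq α' h
      have hq0 : q ≠ 0 := fun h => by rw [h] at hqγ; simp at hqγ
      obtain ⟨α₀, hlt, d', hd'0, hq'⟩ := exists_lt_of_coeff_eq_zero A r (φ β) d hd' q hq hq0
      have hle := hφmin γ α₀ ⟨d', q, hd'0, hq', hqγ, hqz⟩
      rw [← heq] at hle
      exact absurd hlt (not_lt.2 hle)
    · -- eliminate the `v_{φ β}`-coefficient: `p' = p - (c α / d α) q ∈ V_{< φ β}` has leading term `β`
      set k : K := c (φ β) / d (φ β) with hk
      set p' : ι → K := fun j => p j - k * q j with hp'def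
      set c' : ι → K := fun α' => c α' - k * d α' with hc'def
      have hc'0 : ∀ α', r (φ β) ≤ r α' → c' α' = 0 := by
        intro α' h
        rcases h.eq_or_lt with h | h
        · have e : α' = φ β := (hr h).symm
          rw [e]
          simp only [hc'def, hk]
          field_simp
          ring
        · simp [hc'def, hc α' h, hdq α' h]
      have hp'eq : p' = fun j => ∑ α', c' α' * A α' j := by
        funext j
        simp only [hp'def, hc'def, hp, hq, sub_mul, Finset.sum_sub_distrib, Finset.mul_sum, mul_assoc]
      have hp'β : p' β = 1 := by simp [hp'def, hpβ, hqz β hβγ]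
      have hp'z : ∀ β', w β' < w β → p' β' = 0 := by
        intro β' h
        simp [hp'def, hpz β' h, hqz β' (h.trans hβγ)]
      have hp'0 : p' ≠ 0 := fun h => by rw [h] at hp'β; simp at hp'β
      obtain ⟨α₀, hlt, d', hd'0, hq'⟩ := exists_lt_of_coeff_eq_zero A r (φ β) c' hc'0 p' hp'eq hp'0
      have hle := hφmin β α₀ ⟨d', p', hd'0, hq', hp'β, hp'z⟩
      exact absurd hlt (not_lt.2 hle)
  intro β γ heq
  by_contra hne
  rcases lt_or_gt_of_ne (hw.ne hne) with h | h
  · exact key β γ h heq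
  · exact key γ β h heq.symm

end OneFactor

/-! ## Three factors: the antichain support maps into the support in the new bases -/

section ThreeFactors

variable {K : Type*} [Field K] {ι κ μ : Type*} [Fintype ι] [Fintype κ] [Fintype μ]
variable [DecidableEq ι] [DecidableEq κ] [DecidableEq μ]

omit [DecidableEq ι] [DecidableEq κ] [DecidableEq μ] in
/-- The trilinear form of `t` as a single sum in the first argument. [folklore] -/
theorem sum_trilinear_eq_sum₁ (t : ι → κ → μ → K) (p : ι → K) (q : κ → K) (s : μ → K) :
    ∑ a, ∑ b, ∑ c, p a * q b * s c * t a b c = ∑ a, p a * ∑ b, ∑ c, q b * s c * t a b c := by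
  refine Finset.sum_congr rfl fun a _ => ?_
  rw [Finset.mul_sum]
  refine Finset.sum_congr rfl fun b _ => ?_
  rw [Finset.mul_sum]
  exact Finset.sum_congr rfl fun c _ => by ring

omit [DecidableEq ι] [DecidableEq κ] [DecidableEq μ] in
/-- The trilinear form of `t` as a single sum in the second argument. [folklore] -/
theorem sum_trilinear_eq_sum₂ (t : ι → κ → μ → K) (p : ι → K) (q : κ → K) (s : μ → K) :
    ∑ a, ∑ b, ∑ c, p a * q b * s c * t a b c = ∑ b, q b * ∑ a, ∑ c, p a * s c * t a b c := by
  rw [Finset.sum_comm]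
  refine Finset.sum_congr rfl fun b _ => ?_
  rw [Finset.mul_sum]
  refine Finset.sum_congr rfl fun a _ => ?_
  rw [Finset.mul_sum]
  exact Finset.sum_congr rfl fun c _ => by ring

omit [DecidableEq ι] [DecidableEq κ] [DecidableEq μ] in
/-- The trilinear form of `t` as a single sum in the third argument. [folklore] -/
theorem sum_trilinear_eq_sum₃ (t : ι → κ → μ → K) (p : ι → K) (q : κ → K) (s : μ → K) :
    ∑ a, ∑ b, ∑ c, p a * q b * s c * t a b c = ∑ c, s c * ∑ a, ∑ b, p a * q b * t a b c := by
  calc ∑ a, ∑ b, ∑ c, p a * q b * s c * t a b c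
      = ∑ a, ∑ c, ∑ b, p a * q b * s c * t a b c := Finset.sum_congr rfl fun a _ => Finset.sum_comm
    _ = ∑ c, ∑ a, ∑ b, p a * q b * s c * t a b c := Finset.sum_comm
    _ = ∑ c, s c * ∑ a, ∑ b, p a * q b * t a b c := by
        refine Finset.sum_congr rfl fun c _ => ?_
        rw [Finset.mul_sum]
        refine Finset.sum_congr rfl fun a _ => ?_
        rw [Finset.mul_sum]
        exact Finset.sum_congr rfl fun b _ => by ring

omit [DecidableEq ι] [DecidableEq κ] [DecidableEq μ] in
/-- Linearity of the trilinear form in the first argument, for a combination of rows of `A`.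
[folklore] -/
theorem sum_trilinear_lin₁ (t : ι → κ → μ → K) (A : Matrix ι ι K) (c₁ : ι → K) (q : κ → K)
    (s : μ → K) :
    ∑ a, ∑ b, ∑ c, (∑ α, c₁ α * A α a) * q b * s c * t a b c =
      ∑ α, c₁ α * ∑ a, ∑ b, ∑ c, A α a * q b * s c * t a b c := by
  rw [sum_trilinear_eq_sum₁]
  simp only [Finset.sum_mul]
  rw [Finset.sum_comm]
  refine Finset.sum_congr rfl fun α _ => ?_
  rw [sum_trilinear_eq_sum₁, Finset.mul_sum]
  exact Finset.sum_congr rfl fun a _ => by ring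

omit [DecidableEq ι] [DecidableEq κ] [DecidableEq μ] in
/-- Linearity of the trilinear form in the second argument, for a combination of rows of `B`.
[folklore] -/
theorem sum_trilinear_lin₂ (t : ι → κ → μ → K) (B : Matrix κ κ K) (p : ι → K) (c₂ : κ → K)
    (s : μ → K) :
    ∑ a, ∑ b, ∑ c, p a * (∑ β, c₂ β * B β b) * s c * t a b c =
      ∑ β, c₂ β * ∑ a, ∑ b, ∑ c, p a * B β b * s c * t a b c := by
  rw [sum_trilinear_eq_sum₂]
  simp only [Finset.sum_mul]
  rw [Finset.sum_comm]
  refine Finset.sum_congr rfl fun β _ => ?_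
  rw [sum_trilinear_eq_sum₂, Finset.mul_sum]
  exact Finset.sum_congr rfl fun b _ => by ring

omit [DecidableEq ι] [DecidableEq κ] [DecidableEq μ] in
/-- Linearity of the trilinear form in the third argument, for a combination of rows of `C`.
[folklore] -/
theorem sum_trilinear_lin₃ (t : ι → κ → μ → K) (C : Matrix μ μ K) (p : ι → K) (q : κ → K)
    (c₃ : μ → K) :
    ∑ a, ∑ b, ∑ c, p a * q b * (∑ γ, c₃ γ * C γ c) * t a b c =
      ∑ γ, c₃ γ * ∑ a, ∑ b, ∑ c, p a * q b * C γ c * t a b c := by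
  rw [sum_trilinear_eq_sum₃]
  simp only [Finset.sum_mul]
  rw [Finset.sum_comm]
  refine Finset.sum_congr rfl fun γ _ => ?_
  rw [sum_trilinear_eq_sum₃, Finset.mul_sum]
  exact Finset.sum_congr rfl fun c _ => by ring

omit [DecidableEq ι] [DecidableEq κ] [DecidableEq μ] in
/-- Expansion of the trilinear form on vectors of the three row spaces in terms of the coordinates
`(A ⊗ B ⊗ C)·t`. [folklore] -/
theorem sum_trilinear_rows (t : ι → κ → μ → K) (A : Matrix ι ι K) (B : Matrix κ κ K)
    (C : Matrix μ μ K) (c₁ : ι → K) (c₂ : κ → K) (c₃ : μ → K) :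
    ∑ a, ∑ b, ∑ c, (∑ α, c₁ α * A α a) * (∑ β, c₂ β * B β b) * (∑ γ, c₃ γ * C γ c) * t a b c =
      ∑ α, c₁ α * ∑ β, c₂ β * ∑ γ, c₃ γ * actTensor A B C t α β γ := by
  rw [sum_trilinear_lin₁]
  refine Finset.sum_congr rfl fun α _ => ?_
  congr 1
  rw [sum_trilinear_lin₂]
  refine Finset.sum_congr rfl fun β _ => ?_
  congr 1
  rw [sum_trilinear_lin₃]
  refine Finset.sum_congr rfl fun γ _ => ?_
  congr 1

omit [DecidableEq ι] [DecidableEq κ] [DecidableEq μ] in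
/-- Evaluation of the trilinear form of a tensor with antichain support (for the weights `wᵢ`) on
vectors with leading terms `x₁, x₂, x₃`, `x ∈ supp t`: only the term `t(x)` survives ("since `β` is
maximal, the sum over `β' > β` equals zero", CVZ proof of Prop. 2.16).
[cite: ChristandlVranaZuiddam2023, Prop. 2.16] -/
theorem sum_trilinear_leading {W₁ W₂ W₃ : Type*} [LinearOrder W₁] [LinearOrder W₂] [LinearOrder W₃]
    (t : ι → κ → μ → K) (w₁ : ι → W₁) (w₂ : κ → W₂) (w₃ : μ → W₃)
    (hanti : ∀ x ∈ tensorSupport t, ∀ y ∈ tensorSupport t,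
      w₁ x.1 ≤ w₁ y.1 → w₂ x.2.1 ≤ w₂ y.2.1 → w₃ x.2.2 ≤ w₃ y.2.2 → y = x)
    {x : ι × κ × μ} (hx : x ∈ tensorSupport t) {p : ι → K} {q : κ → K} {s : μ → K}
    (hp1 : p x.1 = 1) (hp0 : ∀ β', w₁ β' < w₁ x.1 → p β' = 0)
    (hq1 : q x.2.1 = 1) (hq0 : ∀ β', w₂ β' < w₂ x.2.1 → q β' = 0)
    (hs1 : s x.2.2 = 1) (hs0 : ∀ β', w₃ β' < w₃ x.2.2 → s β' = 0) :
    ∑ a, ∑ b, ∑ c, p a * q b * s c * t a b c = t x.1 x.2.1 x.2.2 := by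
  have e : ∑ a, ∑ b, ∑ c, p a * q b * s c * t a b c =
      ∑ y : ι × κ × μ, p y.1 * q y.2.1 * s y.2.2 * t y.1 y.2.1 y.2.2 := by
    simp only [Fintype.sum_prod_type]
  rw [e, Finset.sum_eq_single x]
  · rw [hp1, hq1, hs1]; ring
  · intro y _ hy
    by_cases h1 : w₁ y.1 < w₁ x.1
    · rw [hp0 _ h1]; ring
    by_cases h2 : w₂ y.2.1 < w₂ x.2.1
    · rw [hq0 _ h2]; ring
    by_cases h3 : w₃ y.2.2 < w₃ x.2.2
    · rw [hs0 _ h3]; ring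
    have ht : t y.1 y.2.1 y.2.2 = 0 := by
      by_contra hne
      exact hy (hanti x hx y hne (not_lt.1 h1) (not_lt.1 h2) (not_lt.1 h3))
    rw [ht]; ring
  · intro h; exact absurd (Finset.mem_univ x) h

/-- **CVZ Prop. 2.16 for an antichain support, three factors.** Let `t` have antichain support for
the injective weights `w₁, w₂, w₃`, let `A, B, C` be invertible and `r₁, r₂, r₃` injective ranks on the
new index sets. There are injections `φ₁, φ₂, φ₃` such that every `x ∈ supp t` is dominated, in the
ranks, by a point of the support of `(A ⊗ B ⊗ C)·t`: some `y` with `((A ⊗ B ⊗ C)·t)(y) ≠ 0` and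
`rᵢ yᵢ ≤ rᵢ (φᵢ xᵢ)` (`i = 1,2,3`). Equivalently `(φ₁ × φ₂ × φ₃)(supp t)` lies in the closure of
`supp ((A ⊗ B ⊗ C)·t)` for the increasing flags of the new bases.
[cite: ChristandlVranaZuiddam2023, Prop. 2.16] -/
theorem exists_injective_support_le {W₁ W₂ W₃ : Type*} [LinearOrder W₁] [LinearOrder W₂]
    [LinearOrder W₃] {R₁ R₂ R₃ : Type*} [LinearOrder R₁] [LinearOrder R₂] [LinearOrder R₃]
    (t : ι → κ → μ → K) (w₁ : ι → W₁) (w₂ : κ → W₂) (w₃ : μ → W₃)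
    (hw₁ : Function.Injective w₁) (hw₂ : Function.Injective w₂) (hw₃ : Function.Injective w₃)
    (hanti : ∀ x ∈ tensorSupport t, ∀ y ∈ tensorSupport t,
      w₁ x.1 ≤ w₁ y.1 → w₂ x.2.1 ≤ w₂ y.2.1 → w₃ x.2.2 ≤ w₃ y.2.2 → y = x)
    (r₁ : ι → R₁) (r₂ : κ → R₂) (r₃ : μ → R₃) (hr₁ : Function.Injective r₁)
    (hr₂ : Function.Injective r₂) (hr₃ : Function.Injective r₃)
    (A : Matrix ι ι K) (B : Matrix κ κ K) (C : Matrix μ μ K)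
    (hA : IsUnit A.det) (hB : IsUnit B.det) (hC : IsUnit C.det) :
    ∃ (φ₁ : ι → ι) (φ₂ : κ → κ) (φ₃ : μ → μ), Function.Injective φ₁ ∧ Function.Injective φ₂ ∧
      Function.Injective φ₃ ∧ ∀ x ∈ tensorSupport t, ∃ y ∈ tensorSupport (actTensor A B C t),
        r₁ y.1 ≤ r₁ (φ₁ x.1) ∧ r₂ y.2.1 ≤ r₂ (φ₂ x.2.1) ∧ r₃ y.2.2 ≤ r₃ (φ₃ x.2.2) := by
  obtain ⟨φ₁, hφ₁, h₁⟩ := exists_injective_leading A hA r₁ hr₁ w₁ hw₁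
  obtain ⟨φ₂, hφ₂, h₂⟩ := exists_injective_leading B hB r₂ hr₂ w₂ hw₂
  obtain ⟨φ₃, hφ₃, h₃⟩ := exists_injective_leading C hC r₃ hr₃ w₃ hw₃
  refine ⟨φ₁, φ₂, φ₃, hφ₁, hφ₂, hφ₃, fun x hx => ?_⟩
  obtain ⟨c₁, p, hc₁, hp, hp1, hp0⟩ := h₁ x.1
  obtain ⟨c₂, q, hc₂, hq, hq1, hq0⟩ := h₂ x.2.1
  obtain ⟨c₃, s, hc₃, hs, hs1, hs0⟩ := h₃ x.2.2
  have hval := sum_trilinear_leading t w₁ w₂ w₃ hanti hx hp1 hp0 hq1 hq0 hs1 hs0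
  have hne : ∑ a, ∑ b, ∑ c, p a * q b * s c * t a b c ≠ 0 := by
    rw [hval]; exact hx
  rw [hp, hq, hs, sum_trilinear_rows] at hne
  obtain ⟨α, -, hα⟩ := Finset.exists_ne_zero_of_sum_ne_zero hne
  obtain ⟨hcα, hα'⟩ := mul_ne_zero_iff.1 hα
  obtain ⟨β, -, hβ⟩ := Finset.exists_ne_zero_of_sum_ne_zero hα'
  obtain ⟨hcβ, hβ'⟩ := mul_ne_zero_iff.1 hβ
  obtain ⟨γ, -, hγ⟩ := Finset.exists_ne_zero_of_sum_ne_zero hβ'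
  obtain ⟨hcγ, hγ'⟩ := mul_ne_zero_iff.1 hγ
  refine ⟨(α, β, γ), hγ', ?_, ?_, ?_⟩
  · exact not_lt.1 fun h => hcα (hc₁ α h)
  · exact not_lt.1 fun h => hcβ (hc₂ β h)
  · exact not_lt.1 fun h => hcγ (hc₃ γ h)

end ThreeFactors

end Literature.Computability.AlgebraicComplexity

end
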